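import Summits.BirchSwinnertonDyer.BirchSwinnertonDyer.Theorems.SignedBaseChangeAnticyclotomicEisensteinDivisibilityFinitePieceDescent
import Literature.NumberTheory.EllipticCurves.TwoVariableAnticyclotomicControl
import Literature.NumberTheory.EllipticCurves.SelmerInftyTorsionPowKummerLiftProofs
import Literature.NumberTheory.EllipticCurves.IwasawaSelmerDualProofs
import HarnessLib

/-!
# Relative descent along `Gal(K̃_∞/K_∞^{(2)}) ≅ ℤ_p` WITHOUT the obstruction: `γ₁`-invariant classes of
# `H¹(K̃_∞, M)` come from `H¹(K_∞^{(2)}, M)` when `M` has no non-zero `Gal(K̄/K̃_∞)`-fixed point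
# (line `bdpline` v13, cohomological core `stub_resOntoInvariantsSS` of the exact-control stub TS2, crux stmt-BirchSwinnertonDyer-20727)

Helper file (`--supports stmt-BirchSwinnertonDyer-20727`) of the lead-prover seat bsd-line-sbc-p1 (gen 2).
The registered stub `stub_resOntoInvariantsSS` of skeleton v13 asks that restriction
`Sel_v̄(E/K_∞⁻) → H¹_{nr,v̄}(K̃_∞, E[p^∞])` be onto the `conj_{γ₁}`-fixed classes. Its GLOBAL half is the
surjectivity of `res : H¹(Gal(K̄/K_∞^{(2)}), M) → H¹(Gal(K̄/K̃_∞), M)^{⟨γ₁⟩}` for `M = E[p^∞]`, where — unlike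
the FINITE-coefficient descents of the tree (`ZpDescent.exists_resSubgroup_eq_of_conjH1_eq`, base `Γ_K`,
and `SignedBaseChangeAcDivFinitePiece.exists_resOfLe_eq_of_conjH1_eq_pair`, relative step along `γ₂`,
both for `p • M = 0`, Greenberg LNM 1716 §3 Lemma 3.2) — the transgression obstruction vanishes OUTRIGHT:
`E(K̃_∞)[p^∞] = 0` as soon as `E(K)[p] = 0` (tree `fixedPoints_pairKer_geomPrimaryTorsion_eq_bot`). This file
proves that variant for FINITE coefficients (the case to which `E[p^∞]` reduces cocycle by cocycle):

* `exists_resOfLe_eq_of_conjH1_eq_pair_of_fixed` — for `ℤ_p`-extensions `(κ₁, κ₂)` of a number field with a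
  topological generator pair `(γ₁, γ₂)`, a finite discrete `Γ_K`-module `M` with open stabilisers and
  `M^{Gal(K̄/K̃_∞)} = 0`, every `x ∈ H¹(K̃_∞, M)` with `conj_{γ₁} x = x` is `res y` for some
  `y ∈ H¹(K_∞^{(2)}, M)` (`K_∞^{(2)} = K̄^{ker κ₂}`, the `κ₂`-tower; for `κ₂` anticyclotomic: `K_∞⁻`).

The proof is the tree's extension argument (`ZpDescent.ExtData / ext / ext_mul`: `ĉ(γᵏ n u) = s_k + γᵏ c(n)`
at the level `U₀ ∩ ker κ₂`, `U₀ ⊴ Γ_K` open, fixing `M` and killing the cocycle near `1`) in the compact group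
`ker κ₂` with `N = pairKer`, `γ = γ₁` (generation: `eq_top_of_isOpen_of_subgroupOf_pairKer_le` for the swapped
pair); the obstruction `c(n₀) − s_{t₀}` is `N`-fixed (as there) hence ZERO by hypothesis — no deeper level,
no `p • M = 0`. Serre, *Galois Cohomology*, I.§2.6 (b); Greenberg, LNM 1716, §3 Lemma 3.2.
Nothing about elliptic curves is asserted; no new definitions.
-/

-- D-0017: single-problem summit, the namespace repeats the problem name by design.
set_option linter.dupNamespace false
set_option autoImplicit false

open scoped Classical

open Literature.NumberTheory.EllipticCurves Literature.NumberTheory.GaloisRepresentations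
open Literature.NumberTheory.EllipticCurves.ZpDescent
open Summit.BirchSwinnertonDyer.BirchSwinnertonDyer.Theorems.SignedBaseChangeAcDivFinitePiece

namespace Summit.BirchSwinnertonDyer.BirchSwinnertonDyer.Theorems.SignedBaseChangeAcDivExactControl

universe u

variable {K : Type u} [Field K] {p : ℕ} [Fact p.Prime]
  {κ₁ κ₂ : ZpExtension K p} {γ₁ γ₂ : Field.absoluteGaloisGroup K}

section Finite

variable {M : Type u} [AddCommGroup M] [DistribMulAction (Field.absoluteGaloisGroup K) M]
  [TopologicalSpace M] [DiscreteTopology M]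

/-- **Relative descent along `Gal(K̃_∞/K_∞^{(2)}) ≅ ℤ_p` when `M^{Gal(K̄/K̃_∞)} = 0`.** Let `(κ₁, κ₂)` be
`ℤ_p`-extensions of the number field `K` with a topological generator pair `(γ₁, γ₂)`,
`N₂ = pairKer κ₁ κ₂ = Gal(K̄/K̃_∞)`, `N₁ = ker κ₂ = Gal(K̄/K_∞^{(2)})`, and `M` a finite discrete `Γ_K`-module
with open stabilisers and NO non-zero `N₂`-fixed point. Then every `x ∈ H¹(N₂, M)` with `conj_{γ₁} x = x` is
`res y` for some `y ∈ H¹(N₁, M)`: the restriction `H¹(K_∞^{(2)}, M) → H¹(K̃_∞, M)^{⟨γ₁⟩}` is onto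
(inflation–restriction: the obstruction lives in `H²(N₁/N₂, M^{N₂}) = 0`; here on cocycles, the obstruction
`c(n₀) − s_{t₀}` being `N₂`-fixed). [cite: GreenbergLNM1716, §3 Lemma 3.2]
[cite: SerreGaloisCohomology1997, I.§2.6 (b)] -/
theorem exists_resOfLe_eq_of_conjH1_eq_pair_of_fixed [Finite M]
    (hγ : ZpExtension.IsTopGeneratorPair κ₁ κ₂ γ₁ γ₂)
    (hstab : ∀ v : M, IsOpen ((MulAction.stabilizer (Field.absoluteGaloisGroup K) v : Subgroup _) :
      Set (Field.absoluteGaloisGroup K)))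
    (hfix : ∀ v : M, (∀ g ∈ ZpExtension.pairKer κ₁ κ₂, g • v = v) → v = 0)
    (x : subgroupH1 (ZpExtension.pairKer κ₁ κ₂) M)
    (hx : conjH1 (ZpExtension.pairKer κ₁ κ₂) M γ₁ x = x) :
    ∃ y : subgroupH1 κ₂.kerSubgroup M,
      resOfLe M (ZpExtension.pairKer_le_right κ₁ κ₂) y = x := by
  classical
  haveI : CompactSpace (Field.absoluteGaloisGroup K) := absoluteGaloisGroup_compactSpace K
  haveI := compactSpace_kerSubgroup κ₂
  -- the base group `G' = N₁ = ker κ₂`, its subgroup `N = N₂`, the generator `γ = γ₁`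
  let N₁ : Subgroup (Field.absoluteGaloisGroup K) := κ₂.kerSubgroup
  let N : Subgroup N₁ := (ZpExtension.pairKer κ₁ κ₂).subgroupOf κ₂.kerSubgroup
  have hNmem : ∀ {g : N₁}, g ∈ N ↔ (g : Field.absoluteGaloisGroup K) ∈ ZpExtension.pairKer κ₁ κ₂ :=
    Subgroup.mem_subgroupOf
  let γ : N₁ := ⟨γ₁, hγ.2.1⟩
  have hgen : ∀ H : Subgroup N₁, IsOpen (H : Set N₁) → N ≤ H → γ ∈ H → H = ⊤ := by
    intro H hH hNH hγH
    refine eq_top_of_isOpen_of_subgroupOf_pairKer_le hγ.symm H hH (fun g hg ↦ hNH ?_) hγH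
    rw [Subgroup.mem_subgroupOf, ← ZpExtension.pairKer_comm] at hg
    exact hNmem.mpr hg
  obtain ⟨φ, rfl⟩ := oneCocycleClass_surjective _ x
  -- the cocycle as a function on `N₁`
  let c : N₁ → M := fun g ↦
    if hg : (g : Field.absoluteGaloisGroup K) ∈ ZpExtension.pairKer κ₁ κ₂ then φ.1 ⟨g, hg⟩ else 0
  have hcN : ∀ (g : N₁) (hg : (g : Field.absoluteGaloisGroup K) ∈ ZpExtension.pairKer κ₁ κ₂),
      c g = φ.1 ⟨g, hg⟩ := fun g hg ↦ dif_pos hg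
  have hc : IsCocycleOn N c := by
    intro h hh h' hh'
    rw [hcN _ (hNmem.mp (N.mul_mem hh hh')), hcN _ (hNmem.mp hh), hcN _ (hNmem.mp hh')]
    exact φ.2 ⟨h, hNmem.mp hh⟩ ⟨h', hNmem.mp hh'⟩
  -- (⋆) from `γ₁`-invariance
  have hconjφ : conjH1 (ZpExtension.pairKer κ₁ κ₂) M γ₁ (oneCocycleClass _ φ) = oneCocycleClass _
      (contOneCocycles.pullback (subgroupConj (ZpExtension.pairKer κ₁ κ₂) γ₁)
        (resHomOfEquivariant (subgroupConj (ZpExtension.pairKer κ₁ κ₂) γ₁)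
          (DistribSMul.toAddMonoidHom M γ₁) (fun x m ↦ by
          simp only [DistribSMul.toAddMonoidHom_apply, Subgroup.smul_def, subgroupConj_apply_coe,
            smul_smul, mul_assoc, mul_inv_cancel_left])) φ) :=
    map_oneCocycleClass _ _ _ φ
  rw [hconjφ, ← sub_eq_zero, ← oneCocycleClass_sub, oneCocycleClass_eq_zero_iff] at hx
  obtain ⟨m, hm⟩ := hx
  have hstar : ∀ h ∈ N, conjTwist γ c h = c h + cob m h := by
    intro h hh
    have hh' : (h : Field.absoluteGaloisGroup K) ∈ ZpExtension.pairKer κ₁ κ₂ := hNmem.mp hh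
    have := hm ⟨h, hh'⟩
    rw [Submodule.coe_sub, ContinuousMap.sub_apply, contOneCocycles.pullback_apply] at this
    change γ₁ • φ.1 (subgroupConj (ZpExtension.pairKer κ₁ κ₂) γ₁ ⟨h, hh'⟩) - φ.1 ⟨h, hh'⟩ =
      (h : Field.absoluteGaloisGroup K) • m - m at this
    have hconj : ((γ⁻¹ * h * γ : N₁) : Field.absoluteGaloisGroup K) ∈ ZpExtension.pairKer κ₁ κ₂ := by
      simpa using Subgroup.Normal.conj_mem inferInstance (h : Field.absoluteGaloisGroup K) hh' γ₁⁻¹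
    rw [conjTwist_apply, cob_apply, hcN _ hh', hcN _ hconj, Subgroup.smul_def, Subgroup.smul_def]
    rw [sub_eq_iff_eq_add'] at this
    have e0 : (⟨((γ⁻¹ * h * γ : N₁) : Field.absoluteGaloisGroup K), hconj⟩ : ZpExtension.pairKer κ₁ κ₂) =
        subgroupConj (ZpExtension.pairKer κ₁ κ₂) γ₁ ⟨h, hh'⟩ :=
      Subtype.ext (by rw [subgroupConj_apply_coe, Subgroup.coe_mul, Subgroup.coe_mul, Subgroup.coe_inv])
    rw [e0]
    exact this
  -- `U₀`: open normal in `Γ_K`, fixing `M` pointwise and killing `φ` near `1`; the level `U := U₀ ∩ N₁`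
  have hzero : IsOpen {h : ZpExtension.pairKer κ₁ κ₂ | φ.1 h = 0} :=
    (isOpen_discrete ({0} : Set M)).preimage φ.1.continuous
  obtain ⟨O, hO, hOeq⟩ := isOpen_induced_iff.mp hzero
  have h1O : (1 : Field.absoluteGaloisGroup K) ∈ O := by
    have : (1 : ZpExtension.pairKer κ₁ κ₂) ∈ Subtype.val ⁻¹' O := by
      rw [hOeq]; exact contOneCocycles.apply_one φ
    exact this
  obtain ⟨U₀, hU₀⟩ := ProfiniteGrp.exist_openNormalSubgroup_sub_open_nhds_of_one
    ((isOpen_fixator M hstab).inter hO) ⟨fun v ↦ one_smul _ v, h1O⟩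
  have hUM₀ : ∀ u ∈ U₀.toSubgroup, ∀ v : M, u • v = v := fun u hu v ↦ (hU₀ hu).1 v
  have hUc₀' : ∀ x ∈ ZpExtension.pairKer κ₁ κ₂, x ∈ U₀.toSubgroup → ∀ hx, φ.1 ⟨x, hx⟩ = 0 :=
    fun x _ hxU hx ↦ by
      have : (⟨x, hx⟩ : ZpExtension.pairKer κ₁ κ₂) ∈ Subtype.val ⁻¹' O := (hU₀ hxU).2
      rw [hOeq] at this
      exact this
  let U : Subgroup N₁ := U₀.toSubgroup.subgroupOf κ₂.kerSubgroup
  haveI : U.Normal := inferInstance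
  have hUopen : IsOpen (U : Set N₁) := by
    rw [Subgroup.coe_subgroupOf]; exact U₀.isOpen.preimage continuous_subtype_val
  haveI : Finite (N₁ ⧸ (N ⊔ U)) :=
    Subgroup.quotient_finite_of_isOpen _ (Subgroup.isOpen_mono le_sup_right hUopen)
  have hUM : ∀ u ∈ U, ∀ w : M, u • w = w := fun u hu w ↦ by
    rw [Subgroup.smul_def]; exact hUM₀ _ (Subgroup.mem_subgroupOf.mp hu) w
  have hUc : ∀ x ∈ N, x ∈ U → c x = 0 := fun x hx hxU ↦ by
    rw [hcN _ (hNmem.mp hx)]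
    exact hUc₀' _ (hNmem.mp hx) (Subgroup.mem_subgroupOf.mp hxU) _
  -- decomposition of `γ^t`
  set t := orderOf (QuotientGroup.mk γ : N₁ ⧸ (N ⊔ U)) with htdef
  have htpos : 0 < t := orderOf_pos _
  obtain ⟨nt, hnt, ut, hut, hγt⟩ := exists_eq_mul_of_mem_sup' (N := N) U
    ((orderOf_mk_dvd_iff (N := N) (γ := γ) U _).mp dvd_rfl)
  -- the obstruction `ob = c n_t - s_t` is `N`-fixed, hence ZERO
  set ob := c nt - sPow γ m t with hob
  have hobN : ∀ h ∈ N, h • ob = ob := by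
    intro h hh
    have k1 := conjTwist_pow (N := N) γ m hstar t h hh
    have k2 : conjTwist (γ ^ t) c h = c h + cob (c nt) h := by
      rw [hγt, conjTwist_mul]
      rw [conjTwist_congr N nt (hc.conjTwist_of_trivial U hUM hUc hut) h hh]
      exact hc.conjTwist_of_mem hnt h hh
    rw [k2, add_right_inj, cob_apply, cob_apply] at k1
    rw [hob, smul_sub]
    exact sub_eq_sub_iff_sub_eq_sub.mp k1
  have hob0 : ob = 0 := hfix ob fun g hg ↦ by
    have := hobN ⟨g, ZpExtension.pairKer_le_right κ₁ κ₂ hg⟩ (hNmem.mpr hg)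
    rwa [Subgroup.smul_def] at this
  -- **vanishing of the obstruction**: `c n_t = s_t`
  have hkey : c nt = sPow γ m t := by
    rw [← sub_eq_zero, ← hob]
    exact hob0
  -- the extension data
  let D : ExtData N U γ m c :=
    { t := t
      t_pos := htpos
      nt := nt
      ut := ut
      nt_mem := hnt
      ut_mem := hut
      pow_t := hγt
      key := hkey
      dvd_of_mem := fun d n u hn hu e ↦ (orderOf_mk_dvd_iff (N := N) (γ := γ) U d).mpr
        (e ▸ Subgroup.mul_mem _ (Subgroup.mem_sup_left hn) (Subgroup.mem_sup_right hu))
      cover := exists_decomp_of_gen hgen U hUopen }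
  -- the extended cocycle is continuous (right-`U`-invariant, `U` open)
  have hcont : Continuous (ext D) := by
    refine IsLocallyConstant.continuous ((IsLocallyConstant.iff_eventually_eq _).mpr fun g ↦ ?_)
    have hopen : IsOpen ((fun g' ↦ g⁻¹ * g') ⁻¹' (U : Set N₁)) := hUopen.preimage (continuous_const_mul g⁻¹)
    refine Filter.eventually_of_mem (hopen.mem_nhds (by simp [U.one_mem])) fun g' hg' ↦ ?_
    have e : g' = g * (g⁻¹ * g') := by group
    rw [e, ext_mul_of_mem hc hUM hUc D g hg']
  let Φ : contOneCocycles (discreteTopRep N₁ M) :=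
    ⟨⟨ext D, hcont⟩, fun g h ↦ ext_mul hc hUM hUc hstar D g h⟩
  refine ⟨oneCocycleClass _ Φ, ?_⟩
  have hmap : resOfLe M (ZpExtension.pairKer_le_right κ₁ κ₂) (oneCocycleClass _ Φ) = oneCocycleClass _
      (contOneCocycles.pullback (subgroupInclusion (ZpExtension.pairKer_le_right κ₁ κ₂))
        (resHomOfEquivariant (subgroupInclusion (ZpExtension.pairKer_le_right κ₁ κ₂)) (AddMonoidHom.id M)
          (fun _ _ ↦ rfl)) Φ) :=
    map_oneCocycleClass _ _ _ Φ
  rw [hmap]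
  congr 1
  apply Subtype.ext
  ext h
  rw [contOneCocycles.pullback_apply]
  change ext D (subgroupInclusion (ZpExtension.pairKer_le_right κ₁ κ₂) h) = φ.1 h
  have hhN : subgroupInclusion (ZpExtension.pairKer_le_right κ₁ κ₂) h ∈ N := hNmem.mpr h.2
  rw [ext_of_mem hc hUM hUc D hhN]
  exact hcN _ h.2

end Finite

/-! ## §2. Coefficients `E[p^∞]`: reduction to `E[p^J]` by the Kummer lift, and the descent for `E[p^∞]` -/

section PrimaryTorsion

open WeierstrassCurve

variable (W : WeierstrassCurve K) (J : ℕ)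

omit [Fact p.Prime] in
/-- `(E[p^J] ↪ E[p^∞])_*` on `H¹(H, ·)` commutes with restriction along `H ≤ H'` (both composites are the
map of the compatible pair `(H ↪ H', E[p^J] ↪ E[p^∞])`, `resH1Hom_comp`). [folklore] -/
theorem resOfLe_resH1Hom_inclusion {H H' : Subgroup (Field.absoluteGaloisGroup K)} (h : H ≤ H')
    (z : subgroupH1 H' (geomTorsion W ((p ^ J : ℕ) : ℤ))) :
    W.resOfLe p h (resH1Hom (ContinuousMonoidHom.id H')
        (AddSubgroup.inclusion
          (Literature.Barriers.BirchSwinnertonDyer.geomTorsion_pow_le_geomPrimaryTorsion W p J))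
        (fun _ _ ↦ rfl) z) =
      resH1Hom (ContinuousMonoidHom.id H)
        (AddSubgroup.inclusion
          (Literature.Barriers.BirchSwinnertonDyer.geomTorsion_pow_le_geomPrimaryTorsion W p J))
        (fun _ _ ↦ rfl) (resOfLe (geomTorsion W ((p ^ J : ℕ) : ℤ)) h z) := by
  change ((W.resOfLe p h).comp (resH1Hom (ContinuousMonoidHom.id H') _ _)) z =
    ((resH1Hom (ContinuousMonoidHom.id H) _ _).comp (resOfLe (geomTorsion W ((p ^ J : ℕ) : ℤ)) h)) z
  rw [WeierstrassCurve.resOfLe, Literature.NumberTheory.EllipticCurves.resOfLe,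
    Literature.NumberTheory.EllipticCurves.resOfLe, resH1Hom_comp, resH1Hom_comp]
  exact congrArg (fun f : subgroupH1 H' (geomTorsion W ((p ^ J : ℕ) : ℤ)) →+ W.subgroupH1 p H ↦ f z)
    (resH1Hom_congr (ContinuousMonoidHom.ext fun _ ↦ rfl) (AddMonoidHom.ext fun _ ↦ rfl) _ _)

omit [Fact p.Prime] in
/-- `(E[p^J] ↪ E[p^∞])_*` on `H¹(H, ·)` commutes with the conjugation action `conj_σ`
(`resH1Hom_comp`; the tree's `conjH1_torsionToPrimaryH1Sub` is the case `J = 1`). [folklore] -/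
theorem conjH1_resH1Hom_inclusion (H : Subgroup (Field.absoluteGaloisGroup K)) [H.Normal]
    (σ : Field.absoluteGaloisGroup K) (y : subgroupH1 H (geomTorsion W ((p ^ J : ℕ) : ℤ))) :
    W.conjH1 p H σ (resH1Hom (ContinuousMonoidHom.id H)
        (AddSubgroup.inclusion
          (Literature.Barriers.BirchSwinnertonDyer.geomTorsion_pow_le_geomPrimaryTorsion W p J))
        (fun _ _ ↦ rfl) y) =
      resH1Hom (ContinuousMonoidHom.id H)
        (AddSubgroup.inclusion
          (Literature.Barriers.BirchSwinnertonDyer.geomTorsion_pow_le_geomPrimaryTorsion W p J))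
        (fun _ _ ↦ rfl) (conjH1 H (geomTorsion W ((p ^ J : ℕ) : ℤ)) σ y) := by
  change ((W.conjH1 p H σ).comp (resH1Hom (ContinuousMonoidHom.id H) _ _)) y =
    ((resH1Hom (ContinuousMonoidHom.id H) _ _).comp (conjH1 H (geomTorsion W ((p ^ J : ℕ) : ℤ)) σ)) y
  rw [WeierstrassCurve.conjH1, Literature.NumberTheory.EllipticCurves.conjH1,
    Literature.NumberTheory.EllipticCurves.conjH1, resH1Hom_comp, resH1Hom_comp]
  exact congrArg (fun f : subgroupH1 H (geomTorsion W ((p ^ J : ℕ) : ℤ)) →+ W.subgroupH1 p H ↦ f y)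
    (resH1Hom_congr (ContinuousMonoidHom.ext fun _ ↦ rfl) (AddMonoidHom.ext fun _ ↦ rfl) _ _)

omit [Fact p.Prime] in
/-- **`(E[p^J] ↪ E[p^∞])_* : H¹(H, E[p^J]) → H¹(H, E[p^∞])` is injective when `E[p^∞]^H = 0`**: its kernel
is the image of the connecting map from `H⁰(H, E[p^∞]) ⧸ p^J` (cohomology of
`0 → E[p^J] → E[p^∞] → E[p^∞] → 0`); on cocycles, `ι ∘ φ = ∂a` forces `p^J a ∈ E[p^∞]^H = 0`, so
`a ∈ E[p^J]` and `φ = ∂a`. [cite: GreenbergLNM1716, §3 Lemma 3.1 (PDF p. 86)] -/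
theorem resH1Hom_inclusion_injective_of_forall_fixed_eq_zero (H : Subgroup (Field.absoluteGaloisGroup K))
    (hfix : ∀ m : geomPrimaryTorsion W p, (∀ g ∈ H, g • m = m) → m = 0) :
    Function.Injective (resH1Hom (ContinuousMonoidHom.id H)
        (AddSubgroup.inclusion
          (Literature.Barriers.BirchSwinnertonDyer.geomTorsion_pow_le_geomPrimaryTorsion W p J))
        (fun _ _ ↦ rfl) :
      subgroupH1 H (geomTorsion W ((p ^ J : ℕ) : ℤ)) → W.subgroupH1 p H) := by
  set ι := AddSubgroup.inclusion
    (Literature.Barriers.BirchSwinnertonDyer.geomTorsion_pow_le_geomPrimaryTorsion W p J) with hι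
  rw [injective_iff_map_eq_zero]
  intro y hy
  obtain ⟨φ, rfl⟩ := oneCocycleClass_surjective _ y
  rw [resH1Hom_id_oneCocycleClass, oneCocycleClass_eq_zero_iff] at hy
  obtain ⟨a, ha⟩ := hy
  -- `p^J • a` is `H`-fixed, hence zero
  have hpJ : ∀ σ : H, p ^ J • (ι (φ.1 σ)) = 0 := fun σ ↦ by
    apply Subtype.ext
    rw [AddSubgroupClass.coe_nsmul, ZeroMemClass.coe_zero, AddSubgroup.coe_inclusion]
    exact AddSubgroup.torsionBy.nsmul_iff.mp (φ.1 σ).2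
  have hfa : ∀ σ : H, σ • (p ^ J • a) = p ^ J • a := fun σ ↦ by
    have h1 : ι (φ.1 σ) = σ • a - a := by
      have := ha σ
      rwa [contOneCocycles.push_apply] at this
    have h2 := hpJ σ
    rw [h1, smul_sub, smul_comm, sub_eq_zero] at h2
    exact h2
  have ha0 : p ^ J • a = 0 := hfix _ fun g hg ↦ by
    have := hfa ⟨g, hg⟩
    rwa [Subgroup.smul_def] at this
  -- so `a ∈ E[p^J]` and `φ = ∂a` there
  have hamem : ((a : geomPrimaryTorsion W p) : geomPoints W) ∈ geomTorsion W ((p ^ J : ℕ) : ℤ) :=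
    AddSubgroup.torsionBy.nsmul_iff.mpr (by
      rw [← AddSubgroupClass.coe_nsmul, ha0, ZeroMemClass.coe_zero])
  rw [oneCocycleClass_eq_zero_iff]
  refine ⟨⟨_, hamem⟩, fun σ ↦ ?_⟩
  apply AddSubgroup.inclusion_injective
    (Literature.Barriers.BirchSwinnertonDyer.geomTorsion_pow_le_geomPrimaryTorsion W p J)
  have := ha σ
  rw [contOneCocycles.push_apply] at this
  rw [← hι, this, map_sub]
  rfl

variable [NumberField K]

/-- **Relative descent along `Gal(K̃_∞/K_∞^{(2)})` for `E[p^∞]`.** For a topological generator pair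
`(γ₁, γ₂)` of `(κ₁, κ₂)` and an elliptic curve with `E(K)[p] = 0` (so that `E(K̃_∞)[p^∞] = 0`,
`fixedPoints_pairKer_geomPrimaryTorsion_eq_bot`), every class `x ∈ H¹(K̃_∞, E[p^∞])` with
`conj_{γ₁} x = x` is the restriction of a (unique) class of `H¹(K_∞^{(2)}, E[p^∞])`. Reduction: `x` is
killed by some `p^J` (compactness), so it is the image of some `y ∈ H¹(K̃_∞, E[p^J])` (Kummer lift
`exists_torsionPowToPrimaryH1Sub_eq`), still `γ₁`-invariant because `(E[p^J] ↪ E[p^∞])_*` is injective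
(`resH1Hom_inclusion_injective_of_forall_fixed_eq_zero`); descend `y` by the finite case
`exists_resOfLe_eq_of_conjH1_eq_pair_of_fixed` and push forward. This is the GLOBAL half of exact
anticyclotomic control (Skinner–Urban 2014 Prop. 3.2.8, surjectivity of `Sel(T/𝔞T) → Sel(T)[𝔞]` before the
local conditions). [cite: GreenbergLNM1716, §3 Lemmas 3.1–3.2] [cite: SkinnerUrban2014, Prop. 3.2.8 (p. 23)] -/
theorem exists_resOfLe_eq_of_conjH1_eq_pair_geomPrimaryTorsion [W.IsElliptic]
    (hγ : ZpExtension.IsTopGeneratorPair κ₁ κ₂ γ₁ γ₂) (hK : ∀ P : W.toAffine.Point, p • P = 0 → P = 0)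
    (x : W.subgroupH1 p (ZpExtension.pairKer κ₁ κ₂))
    (hx : W.conjH1 p (ZpExtension.pairKer κ₁ κ₂) γ₁ x = x) :
    ∃ y : W.subgroupH1 p κ₂.kerSubgroup, W.resOfLe p (ZpExtension.pairKer_le_right κ₁ κ₂) y = x := by
  classical
  have hp := (Fact.out : p.Prime)
  haveI : CompactSpace (Field.absoluteGaloisGroup K) := absoluteGaloisGroup_compactSpace K
  haveI : CompactSpace (ZpExtension.pairKer κ₁ κ₂) :=
    isCompact_iff_compactSpace.mp ((κ₁.isClosed_kerSubgroup.inter κ₂.isClosed_kerSubgroup).isCompact)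
  have hfixP : ∀ m : geomPrimaryTorsion W p, (∀ g ∈ ZpExtension.pairKer κ₁ κ₂, g • m = m) → m = 0 :=
    fun m hm ↦ W.eq_zero_of_forall_pairKer_smul_eq hγ hK hm
  -- Step 1: `p^J x = 0`
  obtain ⟨φ, rfl⟩ := oneCocycleClass_surjective _ x
  obtain ⟨J, hJ⟩ := IwasawaDual.exists_pow_smul_oneCocycleClass_eq_zero (p := p) φ fun σ ↦ by
    obtain ⟨k, hk⟩ := (φ.1 σ).2
    exact ⟨k, Subtype.ext (by rw [AddSubgroupClass.coe_nsmul]; exact hk)⟩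
  -- Step 2: Kummer lift to `E[p^J]`
  obtain ⟨y₀, hy₀⟩ := W.exists_torsionPowToPrimaryH1Sub_eq p (ZpExtension.pairKer κ₁ κ₂) J
    W.zsmul_geomPoints_surjective_holds hJ
  -- Step 3: the lift is `γ₁`-invariant
  have hy₀inv : conjH1 (ZpExtension.pairKer κ₁ κ₂) (geomTorsion W ((p ^ J : ℕ) : ℤ)) γ₁ y₀ = y₀ := by
    apply resH1Hom_inclusion_injective_of_forall_fixed_eq_zero W J (ZpExtension.pairKer κ₁ κ₂) hfixP
    rw [← conjH1_resH1Hom_inclusion, hy₀]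
    exact hx
  -- Step 4: finite descent for `E[p^J]`
  haveI : Finite (geomTorsion W ((p ^ J : ℕ) : ℤ)) :=
    WeierstrassCurve.finite_torsionPoints_holds W (AlgebraicClosure K)
      (by exact_mod_cast (pow_pos hp.pos J).ne')
  haveI : ContinuousSMul (Field.absoluteGaloisGroup K) (geomTorsion W ((p ^ J : ℕ) : ℤ)) :=
    WeierstrassCurve.continuousSMul_geomTorsion W (WeierstrassCurve.isOpen_stabilizer_point_holds W) _
  have hstab : ∀ v : geomTorsion W ((p ^ J : ℕ) : ℤ),
      IsOpen ((MulAction.stabilizer (Field.absoluteGaloisGroup K) v : Subgroup _) :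
        Set (Field.absoluteGaloisGroup K)) := fun v ↦ by
    have : ((MulAction.stabilizer (Field.absoluteGaloisGroup K) v : Subgroup _) :
        Set (Field.absoluteGaloisGroup K)) = (fun g : Field.absoluteGaloisGroup K ↦ g • v) ⁻¹' {v} := by
      ext g
      simp only [SetLike.mem_coe, MulAction.mem_stabilizer_iff, Set.mem_preimage, Set.mem_singleton_iff]
    rw [this]
    exact (isOpen_discrete ({v} : Set _)).preimage (continuous_id.smul continuous_const)
  have hfix : ∀ v : geomTorsion W ((p ^ J : ℕ) : ℤ), (∀ g ∈ ZpExtension.pairKer κ₁ κ₂, g • v = v) → v = 0 :=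
    fun v hv ↦ by
      apply AddSubgroup.inclusion_injective
        (Literature.Barriers.BirchSwinnertonDyer.geomTorsion_pow_le_geomPrimaryTorsion W p J)
      rw [map_zero]
      refine hfixP _ fun g hg ↦ ?_
      have := congrArg (AddSubgroup.inclusion
        (Literature.Barriers.BirchSwinnertonDyer.geomTorsion_pow_le_geomPrimaryTorsion W p J)) (hv g hg)
      exact this
  obtain ⟨z₀, hz₀⟩ := exists_resOfLe_eq_of_conjH1_eq_pair_of_fixed hγ hstab hfix y₀ hy₀inv
  -- Step 5: push forward to `E[p^∞]`
  refine ⟨resH1Hom (ContinuousMonoidHom.id κ₂.kerSubgroup)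
    (AddSubgroup.inclusion
      (Literature.Barriers.BirchSwinnertonDyer.geomTorsion_pow_le_geomPrimaryTorsion W p J))
    (fun _ _ ↦ rfl) z₀, ?_⟩
  rw [resOfLe_resH1Hom_inclusion, hz₀, hy₀]

end PrimaryTorsion

end Summit.BirchSwinnertonDyer.BirchSwinnertonDyer.Theorems.SignedBaseChangeAcDivExactControl
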